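import Mathlib
import HarnessLib
import Literature.NumberTheory.Transcendental.KZCalculus
import Literature.NumberTheory.Transcendental.KZGroundingRelations
import Literature.NumberTheory.Transcendental.KZLogCalculusProofs
import Literature.NumberTheory.Transcendental.SemialgebraicMapsProofs

/-!
# Rational linear base change of Janus band representations (line `janus-bands`)

Rule (2) of the Kontsevich–Zagier calculus for the literal class `JJ B k` of the skeleton
(crux `ArrangementNormalForm`): for an invertible rational matrix `A` (inverse `A⁻¹ = Ainv`),
the substitution `x = A⁻¹ x̃` of the BASE coordinates (fibres unchanged) maps a Janus band
representation `s` with data `(M, L, e, p, a, lo, hi)` to the Janus band representation `s'`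
with data `(M ∘ A⁻¹, L ∘ A⁻¹, e, |det A⁻¹| · p ∘ A⁻¹, a ∘ A⁻¹, lo ∘ A⁻¹, hi ∘ A⁻¹)`
(an affine form `c = (v, c₀)` becomes `(vecMul v A⁻¹, c₀)`), and `[s] − [s'] ∈ KZ.relations`.

Main result: `separatePos_baseChange` (registered sub-goal of `stub_separatePos`): this is the
move that, in base dimension `2`, turns a rational "good direction" of a piece of the base cell
into the distinguished coordinate `y` demanded by the separation engine.
-/

noncomputable section

open Set MeasureTheory MvPolynomial

namespace Summit.KontsevichZagierPeriods.ArrangementNormalForm.JanusBands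

open Literature.NumberTheory.Transcendental

namespace SeparatePos

variable {B k : ℕ}

/-- Matrix inversion identity `∑ₗ P_{il} (∑ⱼ Q_{lj} xⱼ) = xᵢ` for `P * Q = 1`, over `ℝ`. -/
theorem sum_mul_sum_eq_self (P Q : Matrix (Fin B) (Fin B) ℚ) (h : P * Q = 1) (x : Fin B → ℝ)
    (i : Fin B) : ∑ l, (P i l : ℝ) * ∑ j, (Q l j : ℝ) * x j = x i := by
  have key : ∀ j, ∑ l, (P i l : ℝ) * (Q l j : ℝ) = if i = j then 1 else 0 := fun j => by
    have h1 := congr_fun (congr_fun h i) j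
    rw [Matrix.mul_apply, Matrix.one_apply] at h1
    have h2 := congr_arg (fun q : ℚ => (q : ℝ)) h1
    simp only [Rat.cast_sum, Rat.cast_mul] at h2
    rw [h2]
    split_ifs <;> simp
  calc ∑ l, (P i l : ℝ) * ∑ j, (Q l j : ℝ) * x j
      = ∑ j, (∑ l, (P i l : ℝ) * (Q l j : ℝ)) * x j := by
        simp only [Finset.mul_sum, Finset.sum_mul]
        rw [Finset.sum_comm]
        refine Finset.sum_congr rfl fun j _ => Finset.sum_congr rfl fun l _ => ?_
        ring
    _ = x i := by simp [key]

/-- The base substitution `x = A⁻¹ x̃` on affine forms: `c(A⁻¹ x̃) = (vecMul c A⁻¹)(x̃)`. -/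
theorem form_sub (Ainv : Matrix (Fin B) (Fin B) ℚ) (c : (Fin B → ℚ) × ℚ) (w : Fin (B + k) → ℝ) :
    ∑ i, (c.1 i : ℝ) * (Fin.append (fun j => ∑ i, (Ainv j i : ℝ) * w (Fin.castAdd k i))
        (fun i => w (Fin.natAdd B i)) : Fin (B + k) → ℝ) (Fin.castAdd k i) + (c.2 : ℝ) =
      ∑ i, ((Matrix.vecMul c.1 Ainv i : ℚ) : ℝ) * w (Fin.castAdd k i) + (c.2 : ℝ) := by
  simp only [Fin.append_left, Matrix.vecMul, dotProduct, Rat.cast_sum, Rat.cast_mul,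
    Finset.mul_sum, Finset.sum_mul]
  rw [Finset.sum_comm]
  refine congrArg (· + _) (Finset.sum_congr rfl fun j _ => Finset.sum_congr rfl fun l _ => ?_)
  ring

/-- The block matrix `diag(A, 1)` on `ℝ^{B+k}`. -/
theorem blockMat_mulVec (A : Matrix (Fin B) (Fin B) ℚ) (z : Fin (B + k) → ℝ) :
    ((Matrix.fromBlocks (A.map (Rat.castHom ℝ)) 0 0 (1 : Matrix (Fin k) (Fin k) ℝ)).reindex
        finSumFinEquiv finSumFinEquiv).mulVec z =
      Fin.append (fun j => ∑ i, (A j i : ℝ) * z (Fin.castAdd k i))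
        (fun i => z (Fin.natAdd B i)) := by
  ext l
  refine Fin.addCases (fun j => ?_) (fun i => ?_) l
  · simp [Matrix.mulVec, dotProduct, Fin.sum_univ_add, Matrix.fromBlocks_apply₁₁,
      Matrix.fromBlocks_apply₁₂]
  · simp [Matrix.mulVec, dotProduct, Fin.sum_univ_add, Matrix.fromBlocks_apply₂₁,
      Matrix.fromBlocks_apply₂₂, Matrix.one_apply]

/-- The determinant of the block matrix `diag(A, 1)`. -/
theorem blockMat_det (A : Matrix (Fin B) (Fin B) ℚ) :
    ((Matrix.fromBlocks (A.map (Rat.castHom ℝ)) 0 0 (1 : Matrix (Fin k) (Fin k) ℝ)).reindex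
        finSumFinEquiv finSumFinEquiv).det = (A.det : ℝ) := by
  rw [Matrix.det_reindex_self, Matrix.det_fromBlocks_zero₂₁, Matrix.det_one, mul_one,
    show A.map ⇑(Rat.castHom ℝ) = (Rat.castHom ℝ).mapMatrix A from rfl, ← RingHom.map_det]
  rfl

/-- `Sum.elim` through a mapped affine datum. -/
theorem elim_map_eq (t : Fin k → ℝ) (F : ((Fin B → ℚ) × ℚ) → ℝ)
    (g : ((Fin B → ℚ) × ℚ) → ((Fin B → ℚ) × ℚ)) (x : Fin k ⊕ ((Fin B → ℚ) × ℚ)) :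
    Sum.elim t F (Sum.map id g x) = Sum.elim t (F ∘ g) x := by
  cases x <;> rfl

/-- `Option.elim` through a mapped affine datum. -/
theorem optionElim_map_eq (F : ((Fin B → ℚ) × ℚ) → ℝ)
    (g : ((Fin B → ℚ) × ℚ) → ((Fin B → ℚ) × ℚ)) (x : Option ((Fin B → ℚ) × ℚ)) :
    (x.map g).elim (1 : ℝ) F = x.elim 1 (F ∘ g) := by
  cases x <;> rfl

/-- The base substitution as a polynomial map. -/
theorem aeval_subPoly (Ainv : Matrix (Fin B) (Fin B) ℚ) (w : Fin (B + k) → ℝ) :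
    (fun l => MvPolynomial.aeval w ((Fin.append (fun j => ∑ i, MvPolynomial.C (Ainv j i) *
        MvPolynomial.X (Fin.castAdd k i)) (fun i => MvPolynomial.X (Fin.natAdd B i)) :
        Fin (B + k) → MvPolynomial (Fin (B + k)) ℚ) l)) =
      Fin.append (fun j => ∑ i, (Ainv j i : ℝ) * w (Fin.castAdd k i))
        (fun i => w (Fin.natAdd B i)) := by
  funext l
  refine Fin.addCases (fun j => ?_) (fun i => ?_) l
  · simp [map_sum]
  · simp

/-- The numerator under the base substitution `x = A⁻¹ x̃`. -/
theorem aeval_bind_sub (Ainv : Matrix (Fin B) (Fin B) ℚ) (p : MvPolynomial (Fin B) ℚ)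
    (w : Fin (B + k) → ℝ) :
    MvPolynomial.aeval (fun i => w (Fin.castAdd k i))
        (MvPolynomial.bind₁ (fun i => ∑ j, MvPolynomial.C (Ainv i j) * MvPolynomial.X j) p) =
      MvPolynomial.aeval (fun i => (Fin.append (fun j => ∑ i, (Ainv j i : ℝ) * w (Fin.castAdd k i))
        (fun i => w (Fin.natAdd B i)) : Fin (B + k) → ℝ) (Fin.castAdd k i)) p := by
  rw [MvPolynomial.aeval_bind₁]
  refine congrArg (fun v : Fin B → ℝ => MvPolynomial.aeval v p) (funext fun i => ?_)
  simp [map_sum]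

end SeparatePos

open SeparatePos in
/-- **Rational linear base change of a Janus band representation** (rule 2; registered sub-goal
of `stub_separatePos`). Let `s` be a Janus band representation with base `ℝ^B` and `k` fibres
(literal `JJ B k` data `M, L, e, p, a, lo, hi`) and let `A` be an invertible rational `B × B`
matrix with inverse `Ainv`. Substituting `x = A⁻¹ x̃` in the base (the fibres unchanged) gives a
Janus band representation `s'` with the SAME shape and the transformed data
`M' = M ∘ A⁻¹, L' = L ∘ A⁻¹, p' = |det A⁻¹| · p ∘ A⁻¹, a' = a ∘ A⁻¹, lo' = lo ∘ A⁻¹, hi' = hi ∘ A⁻¹`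
(an affine form `(v, c₀)` becomes `(vecMul v A⁻¹, c₀)`), whose domain is the preimage of
`s.domain` under `(x̃, t) ↦ (A⁻¹ x̃, t)`, and `[s] − [s'] ∈ KZ.relations`
(`KZ.changeOfVariablesRel` with the linear map `diag(A, 1)`, Jacobian `|det A|`). -/
theorem separatePos_baseChange (B k m m' : ℕ) (s : KZ.IntegralRep (B + k)) (M : Fin m' → (Fin B → ℚ) × ℚ) (L : Fin m → (Fin B → ℚ) × ℚ) (e : Fin m → ℕ) (p : MvPolynomial (Fin B) ℚ) (a : Fin k → Option ((Fin B → ℚ) × ℚ)) (lo hi : Fin k → Fin k ⊕ ((Fin B → ℚ) × ℚ)) (hbd : Bornology.IsBounded s.domain) (hdom : s.domain = {z | (∀ j, 0 < ∑ i, ((M j).1 i : ℝ) * z (Fin.castAdd k i) + ((M j).2 : ℝ)) ∧ ∀ i, Sum.elim (fun j => z (Fin.natAdd B j)) (fun c => ∑ i', (c.1 i' : ℝ) * z (Fin.castAdd k i') + (c.2 : ℝ)) (lo i) < z (Fin.natAdd B i) ∧ z (Fin.natAdd B i) < Sum.elim (fun j => z (Fin.natAdd B j)) (fun c => ∑ i',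 (c.1 i' : ℝ) * z (Fin.castAdd k i') + (c.2 : ℝ)) (hi i)}) (hint : EqOn s.integrand (fun z => MvPolynomial.aeval (fun i => z (Fin.castAdd k i)) p / (∏ j, (∑ i, ((L j).1 i : ℝ) * z (Fin.castAdd k i) + ((L j).2 : ℝ)) ^ e j) * ∏ i, (a i).elim 1 (fun c => 1 / (z (Fin.natAdd B i) - (∑ i', (c.1 i' : ℝ) * z (Fin.castAdd k i') + (c.2 : ℝ))))) s.domain) (A Ainv : Matrix (Fin B) (Fin B) ℚ) (hA : A * Ainv = 1) (hA' : Ainv * A = 1) : ∃ (M' : Fin m' → (Fin B → ℚ) × ℚ) (L' : Fin m → (Fin B → ℚ) × ℚ) (p' : MvPolynomial (Fin B) ℚ) (a' : Fin k → Option ((Fin B → ℚ) × ℚ)) (lo' hi' : Fin k → Fin k ⊕ ((Fin B → ℚ) × ℚ)) (s' : KZ.IntegralRep (B + k)), (∀ j, M' j = (Matrix.vecMul (M j).1 Ainv, (M j).2)) ∧ (∀ j, L' j = (Matrix.vecMul (L j).1 Ainv, (L j).2)) ∧ p' = MvPolynomial.C |Ainv.det| * MvPolynomial.bind₁ (fun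 i => ∑ j, MvPolynomial.C (Ainv i j) * MvPolynomial.X j) p ∧ (∀ i, a' i = (a i).map (fun c => (Matrix.vecMul c.1 Ainv, c.2))) ∧ (∀ i, lo' i = (lo i).map id (fun c => (Matrix.vecMul c.1 Ainv, c.2))) ∧ (∀ i, hi' i = (hi i).map id (fun c => (Matrix.vecMul c.1 Ainv, c.2))) ∧ (∀ w, w ∈ s'.domain ↔ (Fin.append (fun j => ∑ i, (Ainv j i : ℝ) * w (Fin.castAdd k i)) (fun i => w (Fin.natAdd B i)) : Fin (B + k) → ℝ) ∈ s.domain) ∧ Bornology.IsBounded s'.domain ∧ s'.domain = {z | (∀ j, 0 < ∑ i, ((M' j).1 i : ℝ) * z (Fin.castAdd k i) + ((M' j).2 : ℝ)) ∧ ∀ i, Sum.elim (fun j => z (Fin.natAdd B j)) (fun c => ∑ i', (c.1 i' : ℝ) * z (Fin.castAdd k i') + (c.2 : ℝ)) (lo' i) < z (Fin.natAdd B i) ∧ z (Fin.natAdd B i) < Sum.elim (fun j => z (Fin.natAdd B j)) (fun c => ∑ i', (c.1 i' : ℝ) * z (Fin.castAdd k i') + (c.2 : ℝ)) (hi' i)}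 ∧ EqOn s'.integrand (fun z => MvPolynomial.aeval (fun i => z (Fin.castAdd k i)) p' / (∏ j, (∑ i, ((L' j).1 i : ℝ) * z (Fin.castAdd k i) + ((L' j).2 : ℝ)) ^ e j) * ∏ i, (a' i).elim 1 (fun c => 1 / (z (Fin.natAdd B i) - (∑ i', (c.1 i' : ℝ) * z (Fin.castAdd k i') + (c.2 : ℝ))))) s'.domain ∧ KZ.of s - KZ.of s' ∈ KZ.relations := by
  -- the substitution `Ψ (x̃, t) = (A⁻¹ x̃, t)`, the data map `g`, the constant `κ = |det A⁻¹|`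
  set g : ((Fin B → ℚ) × ℚ) → ((Fin B → ℚ) × ℚ) := fun c => (Matrix.vecMul c.1 Ainv, c.2) with hg
  set Ψ : (Fin (B + k) → ℝ) → (Fin (B + k) → ℝ) := fun w =>
    Fin.append (fun j => ∑ i, (Ainv j i : ℝ) * w (Fin.castAdd k i)) (fun i => w (Fin.natAdd B i))
    with hΨ
  set κ : ℚ := |Ainv.det| with hκ
  set f : (Fin (B + k) → ℝ) → ℝ := fun z => MvPolynomial.aeval (fun i => z (Fin.castAdd k i)) p /
    (∏ j, (∑ i, ((L j).1 i : ℝ) * z (Fin.castAdd k i) + ((L j).2 : ℝ)) ^ e j) *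
    ∏ i, (a i).elim 1 (fun c => 1 / (z (Fin.natAdd B i) -
      (∑ i', (c.1 i' : ℝ) * z (Fin.castAdd k i') + (c.2 : ℝ)))) with hf
  set p' : MvPolynomial (Fin B) ℚ := MvPolynomial.C κ *
    MvPolynomial.bind₁ (fun i => ∑ j, MvPolynomial.C (Ainv i j) * MvPolynomial.X j) p with hp'
  set f' : (Fin (B + k) → ℝ) → ℝ := fun z => MvPolynomial.aeval (fun i => z (Fin.castAdd k i)) p' /
    (∏ j, (∑ i, ((g (L j)).1 i : ℝ) * z (Fin.castAdd k i) + ((g (L j)).2 : ℝ)) ^ e j) *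
    ∏ i, ((a i).map g).elim 1 (fun c => 1 / (z (Fin.natAdd B i) -
      (∑ i', (c.1 i' : ℝ) * z (Fin.castAdd k i') + (c.2 : ℝ)))) with hf'
  set D' : Set (Fin (B + k) → ℝ) := {z | (∀ j, 0 < ∑ i, ((g (M j)).1 i : ℝ) * z (Fin.castAdd k i) +
    ((g (M j)).2 : ℝ)) ∧ ∀ i, Sum.elim (fun j => z (Fin.natAdd B j))
      (fun c => ∑ i', (c.1 i' : ℝ) * z (Fin.castAdd k i') + (c.2 : ℝ)) ((lo i).map id g) <
      z (Fin.natAdd B i) ∧ z (Fin.natAdd B i) < Sum.elim (fun j => z (Fin.natAdd B j))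
      (fun c => ∑ i', (c.1 i' : ℝ) * z (Fin.castAdd k i') + (c.2 : ℝ)) ((hi i).map id g)}
    with hD'
  -- forms under the substitution
  have hform : ∀ (c : (Fin B → ℚ) × ℚ) (w : Fin (B + k) → ℝ),
      ∑ i, (c.1 i : ℝ) * Ψ w (Fin.castAdd k i) + (c.2 : ℝ) =
        ∑ i, ((g c).1 i : ℝ) * w (Fin.castAdd k i) + ((g c).2 : ℝ) := fun c w => form_sub Ainv c w
  have hΨt : ∀ (w : Fin (B + k) → ℝ) i, Ψ w (Fin.natAdd B i) = w (Fin.natAdd B i) := fun w i => by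
    simp [hΨ]
  -- (1) the new domain is the preimage of the old one
  have hΨdom : ∀ w, w ∈ D' ↔ Ψ w ∈ s.domain := fun w => by
    rw [hdom]
    simp only [hD', mem_setOf_eq, hform, hΨt, elim_map_eq]
    rfl
  -- (2) the new integrand is the old one after substitution, times `κ`
  have hff' : ∀ w, f' w = f (Ψ w) * κ := fun w => by
    have h1 : MvPolynomial.aeval (fun i => w (Fin.castAdd k i)) p' =
        (κ : ℝ) * MvPolynomial.aeval (fun i => Ψ w (Fin.castAdd k i)) p := by
      rw [hp', map_mul, MvPolynomial.aeval_C, aeval_bind_sub]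
      simp [hΨ]
    have h2 : ∀ i, ((a i).map g).elim (1 : ℝ) (fun c => 1 / (w (Fin.natAdd B i) -
        (∑ i', (c.1 i' : ℝ) * w (Fin.castAdd k i') + (c.2 : ℝ)))) =
        (a i).elim 1 (fun c => 1 / (Ψ w (Fin.natAdd B i) -
          (∑ i', (c.1 i' : ℝ) * Ψ w (Fin.castAdd k i') + (c.2 : ℝ)))) := fun i => by
      rw [optionElim_map_eq]
      cases a i with
      | none => rfl
      | some c => simp only [Option.elim_some, Function.comp_apply, hform, hΨt]
    simp only [hf', hf, h1, h2, hform]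
    ring
  -- (3) semialgebraicity
  have hD'eq : D' = (fun (w : Fin (B + k) → ℝ) (l : Fin (B + k)) => MvPolynomial.aeval w
      ((Fin.append (fun j => ∑ i, MvPolynomial.C (Ainv j i) * MvPolynomial.X (Fin.castAdd k i))
        (fun i => MvPolynomial.X (Fin.natAdd B i)) :
        Fin (B + k) → MvPolynomial (Fin (B + k)) ℚ) l)) ⁻¹' s.domain := by
    ext w
    rw [mem_preimage, aeval_subPoly, hΨdom w]
  have hD'sa : Literature.ModelTheory.ExponentialFields.IsSemialgebraic ℚ D' := by
    rw [hD'eq]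
    exact s.isSemialgebraic_domain.preimage_aeval _
  have hΨsa : IsSemialgebraicMapOn ℚ D' Ψ :=
    (isSemialgebraicMapOn_aeval hD'sa _).congr fun w _ => aeval_subPoly Ainv w
  have hmaps : MapsTo Ψ D' s.domain := fun w hw => (hΨdom w).1 hw
  have hf'sa : IsSemialgebraicFunOn ℚ D' f' := by
    have hc : IsSemialgebraicFunOn ℚ D' (fun _ => (κ : ℝ)) :=
      (isSemialgebraicFunOn_aeval hD'sa (MvPolynomial.C κ)).congr fun w _ => by simp
    refine (IsSemialgebraicFunOn.mul_holds (IsSemialgebraicFunOn.comp_isSemialgebraicMapOn_holds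
      s.isSemialgebraicFunOn_integrand hΨsa hmaps) hc).congr fun w hw => ?_
    show s.integrand (Ψ w) * κ = f' w
    rw [hint (hmaps hw), hff']
  -- (4) the linear map `diag(A, 1)` and its inverse `Ψ`
  set Lin : (Fin (B + k) → ℝ) →L[ℝ] (Fin (B + k) → ℝ) := LinearMap.toContinuousLinearMap
    (Matrix.toLin' ((Matrix.fromBlocks (A.map (Rat.castHom ℝ)) 0 0
      (1 : Matrix (Fin k) (Fin k) ℝ)).reindex finSumFinEquiv finSumFinEquiv)) with hLin
  have hΦ : ∀ z, Lin z = Fin.append (fun j => ∑ i, (A j i : ℝ) * z (Fin.castAdd k i))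
      (fun i => z (Fin.natAdd B i)) := fun z => by
    rw [hLin, LinearMap.coe_toContinuousLinearMap', Matrix.toLin'_apply, blockMat_mulVec]
  have hΨΦ : ∀ z, Ψ (Lin z) = z := fun z => by
    rw [hΦ]
    funext l
    refine Fin.addCases (fun j => ?_) (fun i => ?_) l
    · simp only [hΨ, Fin.append_left]
      exact sum_mul_sum_eq_self Ainv A hA' _ j
    · simp [hΨ]
  have hΦΨ : ∀ w, Lin (Ψ w) = w := fun w => by
    rw [hΦ]
    funext l
    refine Fin.addCases (fun j => ?_) (fun i => ?_) l
    · simp only [hΨ, Fin.append_left]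
      exact sum_mul_sum_eq_self A Ainv hA _ j
    · simp [hΨ]
  have hdet : Lin.det = (A.det : ℝ) := by
    rw [hLin, ContinuousLinearMap.det, LinearMap.coe_toContinuousLinearMap, LinearMap.det_toLin',
      blockMat_det]
  have hκ : (κ : ℝ) * |(A.det : ℝ)| = 1 := by
    have h1 : A.det * Ainv.det = 1 := by rw [← Matrix.det_mul, hA, Matrix.det_one]
    rw [hκ, Rat.cast_abs, ← abs_mul, ← Rat.cast_mul, mul_comm, h1]
    simp
  have himage : Lin '' s.domain = D' := by
    ext w
    constructor
    · rintro ⟨z, hz, rfl⟩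
      exact (hΨdom _).2 (by rw [hΨΦ]; exact hz)
    · intro hw
      exact ⟨Ψ w, (hΨdom w).1 hw, hΦΨ w⟩
  have hderiv : ∀ z ∈ s.domain, HasFDerivWithinAt (⇑Lin) Lin s.domain z := fun z _ =>
    Lin.hasFDerivAt.hasFDerivWithinAt
  have hinj : InjOn (⇑Lin) s.domain := fun z _ z' _ h => by
    rw [← hΨΦ z, ← hΨΦ z', h]
  have hmeasS : MeasurableSet s.domain := KZ.IntegralRep.measurableSet_domain_holds s
  -- (5) integrability by change of variables
  have hf'int : IntegrableOn f' D' := by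
    rw [← himage, integrableOn_image_iff_integrableOn_abs_det_fderiv_smul volume hmeasS hderiv hinj]
    refine s.integrableOn.congr_fun (fun z hz => ?_) hmeasS
    rw [smul_eq_mul, hff', hΨΦ, hdet, hint hz]
    calc f z = f z * ((κ : ℝ) * |(A.det : ℝ)|) := by rw [hκ, mul_one]
      _ = |(A.det : ℝ)| * (f z * κ) := by ring
  let s' : KZ.IntegralRep (B + k) := ⟨D', f', hD'sa, hf'sa, hf'int⟩
  have hLinsa : IsSemialgebraicMapOn ℚ s.domain ⇑Lin :=
    (isSemialgebraicMapOn_aeval s.isSemialgebraic_domain (Fin.append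
      (fun j => ∑ i, MvPolynomial.C (A j i) * MvPolynomial.X (Fin.castAdd k i))
      (fun i => MvPolynomial.X (Fin.natAdd B i)) :
        Fin (B + k) → MvPolynomial (Fin (B + k)) ℚ)).congr fun z _ => by
      beta_reduce
      rw [aeval_subPoly, hΦ]
  have hcov : KZ.of s - KZ.of s' ∈ KZ.relations :=
    KZ.changeOfVariablesRel_subset_relations ⟨B + k, s, s', ⇑Lin, fun _ => Lin, hLinsa, hderiv,
      hinj, himage.symm, fun z hz => by
        show s.integrand z = f' (Lin z) * |Lin.det|
        rw [hff', hΨΦ, hdet, hint hz, mul_assoc, hκ, mul_one], rfl⟩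
  refine ⟨fun j => g (M j), fun j => g (L j), p', fun i => (a i).map g, fun i => (lo i).map id g,
    fun i => (hi i).map id g, s', fun j => rfl, fun j => rfl, rfl, fun i => rfl, fun i => rfl,
    fun i => rfl, hΨdom, ?_, rfl, fun z _ => rfl, hcov⟩
  show Bornology.IsBounded D'
  rw [← himage]
  exact Lin.lipschitz.isBounded_image hbd

end Summit.KontsevichZagierPeriods.ArrangementNormalForm.JanusBands
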